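import Mathlib

/-!
# Király–Lütkebohmert (ANT 7 (2013), Thm. 2) — lemmas

Helper lemmas for `WildQuotients.KiralyLutkebohmert` (stmt-ResolutionOfSingularities-15643),
following F. Király, W. Lütkebohmert, *Group actions of prime order on local normal rings*,
Algebra & Number Theory 7 (2013) 63–74 (= arXiv:1001.1945), §1:

* values `h_d(z₀,…,zₙ)` of the complete homogeneous symmetric polynomials, packaged WITHOUT a new
  definition as "any table `H` satisfying the last-variable recursion" (`kl_cH_exists` produces
  one), with the first-variable recursion `kl_cH_shift` and the divided-difference identity
  `kl_cH_key` : `h_{d+1}(z₁..z_{n+1}) − h_{d+1}(z₀..zₙ) = (z_{n+1} − z₀) h_d(z₀..z_{n+1})`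
  (this is the formula of Lemma 4 of the paper);
* augmentation generators: existence when the augmentation ideal is principal (§1, p. 64) and
  change of generator of the cyclic group (`kl_span_eq_span_pow_sub`);
* the divided-difference operators `Φₙ` of Lemma 4 / Prop. 5 over a field, again as "any
  sequence of maps satisfying the recursion": their values on powers (`kl_phi_pow`) and their
  integrality (`kl_phi_integral`).

The decomposition `B = ⊕_{i<p} B^σ yⁱ` and the theorem itself are in
`WildQuotientsKiralyLutkebohmert.lean`.
-/

-- single-problem summit: the doubled namespace component `ResolutionOfSingularities` is forced
set_option linter.dupNamespace false

open IsLocalRing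

namespace Summit.ResolutionOfSingularities.ResolutionOfSingularities.Theorems

section CompleteHomogeneous

variable {R : Type*} [CommRing R]

/-- Existence of the table `H z n d = h_d(z 0, …, z n)` of complete homogeneous symmetric
polynomial values, given by the recursion "split off the last variable":
`h_d(z₀) = z₀^d`, `h_0 = 1`, `h_{d+1}(z₀..z_{n+1}) = h_{d+1}(z₀..zₙ) + z_{n+1} h_d(z₀..z_{n+1})`.
[folklore] -/
theorem kl_cH_exists : ∃ H : (ℕ → R) → ℕ → ℕ → R,
    (∀ z d, H z 0 d = z 0 ^ d) ∧ (∀ z n, H z (n + 1) 0 = 1) ∧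
    (∀ z n d, H z (n + 1) (d + 1) = H z n (d + 1) + z (n + 1) * H z (n + 1) d) :=
  ⟨fun z n => Nat.rec (motive := fun _ => ℕ → R) (fun d => z 0 ^ d)
    (fun n Hn d => Nat.rec (motive := fun _ => R) 1 (fun e He => Hn (e + 1) + z (n + 1) * He) d) n,
    fun _ _ => rfl, fun _ _ => rfl, fun _ _ _ => rfl⟩

variable (H : (ℕ → R) → ℕ → ℕ → R)
  (h0 : ∀ z d, H z 0 d = z 0 ^ d) (h1 : ∀ z n, H z (n + 1) 0 = 1)
  (h2 : ∀ z n d, H z (n + 1) (d + 1) = H z n (d + 1) + z (n + 1) * H z (n + 1) d)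

include h0 h1 in
/-- `h_0 = 1`. [folklore] -/
theorem kl_cH_zero_right (z : ℕ → R) (n : ℕ) : H z n 0 = 1 := by
  cases n with
  | zero => rw [h0, pow_zero]
  | succ n => exact h1 z n

include h0 h1 h2 in
/-- The recursion "split off the FIRST variable":
`h_{d+1}(z₀..z_{n+1}) = h_{d+1}(z₁..z_{n+1}) + z₀ h_d(z₀..z_{n+1})`. [folklore] -/
theorem kl_cH_shift (z : ℕ → R) (n d : ℕ) :
    H z (n + 1) (d + 1) = H (fun k => z (k + 1)) n (d + 1) + z 0 * H z (n + 1) d := by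
  induction n generalizing z d with
  | zero =>
    induction d with
    | zero =>
      have e1 := h2 z 0 0
      simp only [h0, h1] at e1 ⊢
      linear_combination e1
    | succ d ih =>
      have e1 := h2 z 0 (d + 1)
      have e2 := ih
      have e3 := h2 z 0 d
      simp only [h0] at e1 e2 e3 ⊢
      linear_combination e1 + z 1 * e2 - z 0 * e3
  | succ n ihn =>
    induction d with
    | zero =>
      have e1 := h2 z (n + 1) 0
      have e2 := ihn z 0
      have e3 := h2 (fun k => z (k + 1)) n 0
      simp only [h1] at e1 e2 e3 ⊢
      linear_combination e1 + e2 - e3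
    | succ d ihd =>
      have e1 := h2 z (n + 1) (d + 1)
      have e2 := ihn z (d + 1)
      have e3 := ihd
      have e4 := h2 (fun k => z (k + 1)) n (d + 1)
      have e5 := h2 z (n + 1) d
      linear_combination e1 + e2 + z (n + 2) * e3 - e4 - z 0 * e5

include h0 h1 h2 in
/-- The two-sided key identity (divided differences of monomials):
`h_{d+1}(z₁..z_{n+1}) − h_{d+1}(z₀..zₙ) = (z_{n+1} − z₀) · h_d(z₀..z_{n+1})`. [folklore] -/
theorem kl_cH_key (z : ℕ → R) (n d : ℕ) :
    H (fun k => z (k + 1)) n (d + 1) - H z n (d + 1) = (z (n + 1) - z 0) * H z (n + 1) d := by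
  have e1 := h2 z n d
  have e2 := kl_cH_shift H h0 h1 h2 z n d
  linear_combination e1 - e2

include h0 h1 h2 in
/-- Ring endomorphisms act on the table variable-wise: `f (h_d(z)) = h_d(f ∘ z)`. [folklore] -/
theorem kl_cH_map (f : R →+* R) (z : ℕ → R) (n d : ℕ) :
    f (H z n d) = H (fun k => f (z k)) n d := by
  induction n generalizing d with
  | zero => rw [h0, h0, map_pow]
  | succ n ihn =>
    induction d with
    | zero => rw [h1, h1, map_one]
    | succ d ihd => rw [h2, h2, map_add, map_mul, ihn, ihd]

end CompleteHomogeneous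

section Augmentation

variable {B : Type*} [CommRing B]

/-- `(σ^(k+1)) b = σ ((σ^k) b)`. [folklore] -/
theorem kl_pow_succ_apply (σ : B ≃+* B) (k : ℕ) (b : B) : (σ ^ (k + 1)) b = σ ((σ ^ k) b) := by
  rw [pow_succ', RingAut.mul_apply]

/-- `(σ^(k+1)) b = (σ^k) (σ b)`. [folklore] -/
theorem kl_pow_succ_apply' (σ : B ≃+* B) (k : ℕ) (b : B) : (σ ^ (k + 1)) b = (σ ^ k) (σ b) := by
  rw [pow_succ, RingAut.mul_apply]

/-- Every `σ^k b − b` lies in the augmentation ideal `(σ b − b : b ∈ B)`. [folklore] -/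
theorem kl_pow_sub_mem_span (σ : B ≃+* B) (k : ℕ) (b : B) :
    (σ ^ k) b - b ∈ Ideal.span (Set.range fun c : B => σ c - c) := by
  induction k with
  | zero => simp
  | succ k ih =>
    have h1 : σ ((σ ^ k) b) - (σ ^ k) b ∈ Ideal.span (Set.range fun c : B => σ c - c) :=
      Ideal.subset_span ⟨(σ ^ k) b, rfl⟩
    have : (σ ^ (k + 1)) b - b = (σ ((σ ^ k) b) - (σ ^ k) b) + ((σ ^ k) b - b) := by
      rw [kl_pow_succ_apply]; ring
    rw [this]
    exact Ideal.add_mem _ h1 ih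

/-- `(τ^m) y − y = ∑_{l<m} (τ^l) (τ y − y)`. [folklore] -/
theorem kl_pow_sub_eq_sum (τ : B ≃+* B) (y : B) (m : ℕ) :
    (τ ^ m) y - y = ∑ l ∈ Finset.range m, (τ ^ l) (τ y - y) := by
  induction m with
  | zero => simp
  | succ m ih =>
    rw [Finset.sum_range_succ, ← ih, map_sub, ← kl_pow_succ_apply', kl_pow_succ_apply' τ m y]
    ring

/-- A ring automorphism maps non-units to non-units. [folklore] -/
theorem kl_map_mem_maximalIdeal [IsLocalRing B] (τ : B ≃+* B) {v : B}
    (hv : v ∈ maximalIdeal B) : τ v ∈ maximalIdeal B := by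
  rw [IsLocalRing.mem_maximalIdeal, mem_nonunits_iff] at hv ⊢
  intro h
  apply hv
  have := h.map τ.symm
  rwa [RingEquiv.symm_apply_apply] at this

/-- If `0 < j < p` with `p` prime then some power of `σ^j` is `σ` (given `σ^p = 1`). [folklore] -/
theorem kl_exists_pow_pow_eq (σ : B ≃+* B) {p : ℕ} (hp : p.Prime) (hσ : σ ^ p = 1) {j : ℕ}
    (hj0 : 0 < j) (hjp : j < p) : ∃ m : ℕ, (σ ^ j) ^ m = σ := by
  obtain ⟨m, -, hm⟩ := Nat.exists_mul_mod_eq_one_of_coprime (Nat.coprime_of_lt_prime hj0.ne' hjp hp).symm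
    hp.one_lt
  refine ⟨m, ?_⟩
  rw [← pow_mul, ← Nat.mod_add_div (j * m) p, pow_add, pow_mul, hσ, one_pow, mul_one, hm, pow_one]

variable [IsDomain B] [IsLocalRing B]

/-- **Change of generator** (Király–Lütkebohmert, remark before Def. 1 / proof of Lemma 4): if
`y` is an augmentation generator for `σ` (`I_G = (σ y − y)`), then it is one for every other
generator `σ^j` (`0 < j < p`) of the cyclic group: `I_G = (σ^j y − y)`.
[cite: KiralyLutkebohmert2013, §1 (p. 64) and Lemma 4] -/
theorem kl_span_eq_span_pow_sub (σ : B ≃+* B) {p : ℕ} (hp : p.Prime) (hσ : σ ^ p = 1) (y : B)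
    (hy : σ y - y ≠ 0)
    (hI : Ideal.span (Set.range fun c : B => σ c - c) = Ideal.span {σ y - y})
    {j : ℕ} (hj0 : 0 < j) (hjp : j < p) :
    Ideal.span (Set.range fun c : B => σ c - c) = Ideal.span {(σ ^ j) y - y} := by
  set x := σ y - y with hx_def
  set τ := σ ^ j with hτ_def
  -- `τ y - y = v * x`
  have hmem : τ y - y ∈ Ideal.span {x} := hI ▸ kl_pow_sub_mem_span σ j y
  obtain ⟨v, hv⟩ := Ideal.mem_span_singleton'.mp hmem
  -- some power of `τ` is `σ`
  obtain ⟨m, hm⟩ := kl_exists_pow_pow_eq σ hp hσ hj0 hjp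
  -- each `τ^l x` is a multiple of `x`
  have hu : ∀ l : ℕ, ∃ u : B, (τ ^ l) x = u * x := by
    intro l
    have : (τ ^ l) x ∈ Ideal.span {x} := by
      rw [← hI, hτ_def, ← pow_mul, hx_def, map_sub, ← kl_pow_succ_apply', kl_pow_succ_apply]
      exact Ideal.subset_span ⟨(σ ^ (j * l)) y, rfl⟩
    obtain ⟨u, hu⟩ := Ideal.mem_span_singleton'.mp this
    exact ⟨u, hu.symm⟩
  choose u hu using hu
  -- `x = (∑ τ^l v * u l) * x`
  have hsum : x = (∑ l ∈ Finset.range m, (τ ^ l) v * u l) * x := by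
    conv_lhs => rw [hx_def, ← hm, kl_pow_sub_eq_sum τ y m]
    rw [Finset.sum_mul]
    refine Finset.sum_congr rfl fun l _ => ?_
    rw [← hv, map_mul, hu l]
    ring
  -- hence `v` is a unit
  have hvunit : IsUnit v := by
    by_contra hvn
    have hvm : v ∈ maximalIdeal B := hvn
    have hS : (∑ l ∈ Finset.range m, (τ ^ l) v * u l) ∈ maximalIdeal B :=
      Ideal.sum_mem _ fun l _ => Ideal.mul_mem_right _ _ (kl_map_mem_maximalIdeal (τ ^ l) hvm)
    have h1 : (1 - ∑ l ∈ Finset.range m, (τ ^ l) v * u l) * x = 0 := by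
      rw [sub_mul, one_mul, ← hsum, sub_self]
    rcases mul_eq_zero.mp h1 with h | h
    · have h1m : (1 : B) ∈ maximalIdeal B := by rw [sub_eq_zero.mp h]; exact hS
      exact mem_nonunits_iff.mp ((IsLocalRing.mem_maximalIdeal _).mp h1m) isUnit_one
    · exact hy h
  -- conclude
  rw [hI, ← hv]
  exact (Ideal.span_singleton_mul_left_unit hvunit x).symm

/-- **Augmentation generators exist** (Király–Lütkebohmert, §1 p. 64, via Nakayama): in a local
domain, if the augmentation ideal `I_G = (σ b − b : b ∈ B)` is principal and nonzero then
`I_G = (σ y − y)` for some `y ∈ B`. [cite: KiralyLutkebohmert2013, §1 (p. 64)] -/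
theorem kl_exists_aug_generator (σ : B ≃+* B)
    (hP : (Ideal.span (Set.range fun c : B => σ c - c)).IsPrincipal)
    (h0 : Ideal.span (Set.range fun c : B => σ c - c) ≠ ⊥) :
    ∃ y : B, σ y - y ≠ 0 ∧
      Ideal.span (Set.range fun c : B => σ c - c) = Ideal.span {σ y - y} := by
  set I := Ideal.span (Set.range fun c : B => σ c - c) with hI_def
  set x := Submodule.IsPrincipal.generator I with hx_def
  have hIx : I = Ideal.span {x} := (Ideal.span_singleton_generator I).symm
  have hx0 : x ≠ 0 := by
    intro h
    apply h0
    rw [hIx, h, Ideal.span_singleton_eq_bot]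
  -- some `σ b - b = d * x` with `d` a unit
  have key : ∃ b d : B, IsUnit d ∧ d * x = σ b - b := by
    by_contra hcon
    push Not at hcon
    have hle : I ≤ maximalIdeal B * Ideal.span {x} := by
      rw [hI_def, Ideal.span_le]
      rintro _ ⟨b, rfl⟩
      have hb : σ b - b ∈ Ideal.span {x} := hIx ▸ (Ideal.subset_span ⟨b, rfl⟩ : σ b - b ∈ I)
      obtain ⟨d, hd⟩ := Ideal.mem_span_singleton'.mp hb
      have hdm : d ∈ maximalIdeal B := by
        simpa [IsLocalRing.mem_maximalIdeal, mem_nonunits_iff] using fun hu => hcon b d hu hd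
      simpa [hd] using Ideal.mul_mem_mul hdm (Ideal.mem_span_singleton_self x)
    have hxI : x ∈ I := hIx ▸ Ideal.mem_span_singleton_self x
    obtain ⟨t, ht, htx⟩ := Ideal.mem_mul_span_singleton.mp (hle hxI)
    have h1 : (t - 1) * x = 0 := by rw [sub_mul, htx, one_mul, sub_self]
    rcases mul_eq_zero.mp h1 with h | h
    · have : (1 : B) ∈ maximalIdeal B := by rwa [sub_eq_zero.mp h] at ht
      exact mem_nonunits_iff.mp ((IsLocalRing.mem_maximalIdeal _).mp this) isUnit_one
    · exact hx0 h
  obtain ⟨b, d, hd, hdx⟩ := key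
  refine ⟨b, ?_, ?_⟩
  · rw [← hdx]
    exact mul_ne_zero hd.ne_zero hx0
  · rw [← hdx, Ideal.span_singleton_mul_left_unit hd, ← hIx]

end Augmentation


section FieldPart

variable {L : Type*} [Field L]

/-- **Lemma 4 of Király–Lütkebohmert** (divided differences of monomials): for operators
`Φ₀ = id`, `Φₙ₊₁ = (z_{n+1} − z₀)⁻¹ (τ ∘ Φₙ − Φₙ)` with `τ zₖ = zₖ₊₁`, one has
`Φₙ (z₀^{n+e}) = h_e(z₀, …, zₙ)` and `Φₙ (z₀^i) = 0` for `i < n`.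
[cite: KiralyLutkebohmert2013, Lemma 4] -/
theorem kl_phi_pow (τ : L →+* L) (z : ℕ → L) (hzs : ∀ k, z (k + 1) = τ (z k))
    (x : ℕ → L) (hxz : ∀ k, x k = z k - z 0)
    (Φ : ℕ → L → L) (hΦ0 : ∀ l, Φ 0 l = l)
    (hΦs : ∀ n l, Φ (n + 1) l = (x (n + 1))⁻¹ * (τ (Φ n l) - Φ n l))
    (H : (ℕ → L) → ℕ → ℕ → L)
    (h0 : ∀ z d, H z 0 d = z 0 ^ d) (h1 : ∀ z n, H z (n + 1) 0 = 1)
    (h2 : ∀ z n d, H z (n + 1) (d + 1) = H z n (d + 1) + z (n + 1) * H z (n + 1) d)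
    (n : ℕ) (hx : ∀ k, 1 ≤ k → k ≤ n → x k ≠ 0) :
    (∀ e, Φ n (z 0 ^ (n + e)) = H z n e) ∧ (∀ i, i < n → Φ n (z 0 ^ i) = 0) := by
  induction n with
  | zero =>
    refine ⟨fun e => ?_, fun i hi => absurd hi (Nat.not_lt_zero _)⟩
    rw [hΦ0, h0, zero_add]
  | succ n ih =>
    obtain ⟨ih1, ih2⟩ := ih (fun k hk1 hk2 => hx k hk1 (Nat.le_succ_of_le hk2))
    have hxn : x (n + 1) ≠ 0 := hx (n + 1) (Nat.succ_le_succ (Nat.zero_le _)) le_rfl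
    have hshift : (fun k => τ (z k)) = fun k => z (k + 1) := funext fun k => (hzs k).symm
    refine ⟨fun e => ?_, fun i hi => ?_⟩
    · rw [hΦs, show n + 1 + e = n + (e + 1) by ring, ih1 (e + 1),
        kl_cH_map H h0 h1 h2 τ z n (e + 1), hshift, kl_cH_key H h0 h1 h2 z n e, ← hxz,
        inv_mul_cancel_left₀ hxn]
    · rcases Nat.lt_succ_iff_lt_or_eq.mp hi with hlt | rfl
      · rw [hΦs, ih2 i hlt, map_zero, sub_zero, mul_zero]
      · have := ih1 0
        rw [add_zero] at this
        rw [hΦs, this, kl_cH_zero_right H h0 h1, map_one, sub_self, mul_zero]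

/-- **Integrality of the divided differences** (Király–Lütkebohmert, proof of Prop. 5): if every
`σ c − c` is divisible by `x_k = σ^k y − y` (`1 ≤ k < p`) then `Φₙ` maps `B` into `B` for
`n < p`. [cite: KiralyLutkebohmert2013, Prop 5 (proof)] -/
theorem kl_phi_integral {B : Type*} [CommRing B] [Algebra B L] {p : ℕ} (σ : B ≃+* B)
    (τ : L →+* L) (hτ : ∀ b, τ (algebraMap B L b) = algebraMap B L (σ b))
    (xB : ℕ → B) (x : ℕ → L) (hxB : ∀ k, x k = algebraMap B L (xB k))
    (hx0 : ∀ k, 1 ≤ k → k < p → x k ≠ 0)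
    (hgen : ∀ k, 1 ≤ k → k < p → ∀ b, σ b - b ∈ Ideal.span {xB k})
    (Φ : ℕ → L → L) (hΦ0 : ∀ l, Φ 0 l = l)
    (hΦs : ∀ n l, Φ (n + 1) l = (x (n + 1))⁻¹ * (τ (Φ n l) - Φ n l))
    (n : ℕ) (hn : n < p) (b : B) : ∃ c : B, Φ n (algebraMap B L b) = algebraMap B L c := by
  induction n with
  | zero => exact ⟨b, hΦ0 _⟩
  | succ n ih =>
    obtain ⟨c, hc⟩ := ih (Nat.lt_of_succ_lt hn)
    have h1n : 1 ≤ n + 1 := Nat.succ_le_succ (Nat.zero_le _)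
    obtain ⟨c', hc'⟩ := Ideal.mem_span_singleton'.mp (hgen (n + 1) h1n hn c)
    refine ⟨c', ?_⟩
    rw [hΦs, hc, hτ, ← map_sub, ← hc', map_mul, ← hxB, mul_comm (algebraMap B L c'),
      inv_mul_cancel_left₀ (hx0 (n + 1) h1n hn)]

end FieldPart

end Summit.ResolutionOfSingularities.ResolutionOfSingularities.Theorems
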